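import Literature.RepresentationTheory.FiniteGroups.SymmetricGroupCyclePeeling
import HarnessLib

/-!
# The fixed-word enumerator is the power-sum product of the cycle type

Topic `Literature/RepresentationTheory/FiniteGroups`. For a permutation `σ` of a finite set `ι`
and `N` variables, the fixed-word enumerator
`F_σ(x) = ∑_{w : ι → [N], w ∘ σ = w} x^{cont(w)}` of `SymmetricGroupFixedWords.lean` factors
completely as

  `F_σ = (∏_{m ∈ cycleType σ} p_m) · p_1 ^ (#ι - ∑ cycleType σ)`,
  `p_m = x_1^m + ⋯ + x_N^m`

(`fixedWordPoly_eq_prod_cycleType`): one power sum per non-trivial cycle (Mathlib's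
`Equiv.Perm.cycleType` lists the lengths `≥ 2`) and one factor `p_1` per fixed point. This is the
statement "`∏_j P_j(x)^{i_j}`" of Frobenius's formula (Fulton–Harris (4.10)) in the form needed
to EVALUATE characters: combined with `spechtCharacter_eq_frobeniusChar` it shows that `χ^λ(σ)`
is `[x^{λ+ρ}] (a_ρ · ∏_{m ∈ cycleType σ} p_m · p_1^{f})`, a function of the cycle type alone
(`frobeniusChar_eq_coeff_prod_cycleType`), which the Murnaghan–Nakayama recursion of the sibling
file `SymmetricGroupCharacterEvaluation.lean` computes.

Proof: strong induction on `#ι`, peeling one cycle at a time with the tree's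
`fixedWordPoly_cycle_mul` (`F_{cτ} = p_{|c|} · F_{τ|B}`) and `cycleType_subtypePerm_of_disjoint`;
the base `F_1 = (x_1 + ⋯ + x_N)^{#ι}` is `fixedWordPoly_one` (every word is fixed by `1`, and
`∑_w ∏_p x_{w p} = ∏_p ∑_i x_i`).

Also here: power sums being symmetric (Mathlib `rename_psum`), `(∏ p_m) · G` is antisymmetric
whenever `G` is (`rename_prod_psum_mul`), the input for the vanishing/sign rules of the evaluation.

## References

* W. Fulton, J. Harris, *Representation Theory. A First Course*, GTM 129 (1991), §4.1 (4.10)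
  ("`P_j(x) = x_1^j + ⋯ + x_k^j`", the cycle-index form of the right-hand side).
  [FultonHarrisGTM129]
* I. G. Macdonald, *Symmetric Functions and Hall Polynomials*, 2nd ed. (1995), Ch. I §7,
  (7.7)–(7.8). [Macdonald1995]

## Mathlib and tree

Mathlib: `Equiv.Perm.mem_cycleType_iff`, `Equiv.Perm.Disjoint.cycleType_mul`,
`Equiv.Perm.IsCycle.cycleType`, `Equiv.Perm.cycleType_eq_zero`, `Finset.prod_univ_sum`,
`Fintype.piFinset_univ`. Tree: `fixedWordPoly`, `fixedWordPoly_cycle_mul`,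
`cycleType_subtypePerm_of_disjoint`, `mem_compl_support_iff_of_disjoint`, `frobeniusChar_def`
(`SymmetricGroupFixedWords.lean`, `SymmetricGroupCyclePeeling.lean`).
-/

noncomputable section

open scoped BigOperators
open MvPolynomial Finset
open Literature.RingTheory.SymmetricFunctions.SymmPoly (alternant rho)

namespace Literature.RepresentationTheory.FiniteGroups

/-! ### Power sums in `N` variables over `ℤ` (Mathlib's `MvPolynomial.psum`) -/

section PowerSums

variable {N : ℕ}

/-- The power sum `p_m = x_1^m + ⋯ + x_N^m ∈ ℤ[x_1, …, x_N]` (Mathlib's `MvPolynomial.psum`)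
is the literal sum used by the tree's `coeff_psum_mul` and `fixedWordPoly_cycle_mul`. [folklore] -/
theorem psum_fin_eq_sum (m : ℕ) :
    psum (Fin N) ℤ m = ∑ i : Fin N, (X i : MvPolynomial (Fin N) ℤ) ^ m := rfl

/-- Products of power sums are symmetric. [folklore] -/
theorem rename_prod_psum (g : Equiv.Perm (Fin N)) (ms : List ℕ) :
    rename g ((ms.map (psum (Fin N) ℤ)).prod) = (ms.map (psum (Fin N) ℤ)).prod := by
  rw [map_list_prod, List.map_map]
  congr 1
  exact List.map_congr_left fun m _ => rename_psum _ _ _ _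

/-- **A product of power sums times an antisymmetric polynomial is antisymmetric.** [folklore] -/
theorem rename_prod_psum_mul (ms : List ℕ) {G : MvPolynomial (Fin N) ℤ}
    {g : Equiv.Perm (Fin N)}
    (hG : rename g G = ((Equiv.Perm.sign g : ℤ) : MvPolynomial (Fin N) ℤ) * G) :
    rename g ((ms.map (psum (Fin N) ℤ)).prod * G) =
      ((Equiv.Perm.sign g : ℤ) : MvPolynomial (Fin N) ℤ) *
        ((ms.map (psum (Fin N) ℤ)).prod * G) := by
  rw [map_mul, rename_prod_psum, hG, mul_left_comm]

/-- The product of power sums over a multiset given by a list is the list product. [folklore] -/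
theorem prod_map_psum_coe (ms : List ℕ) :
    ((ms : Multiset ℕ).map (psum (Fin N) ℤ)).prod = (ms.map (psum (Fin N) ℤ)).prod := by
  rw [Multiset.map_coe, Multiset.prod_coe]

end PowerSums

/-! ### `F_1 = p_1 ^ {#ι}` and the complete factorization -/

section Factorization

variable {N : ℕ}

/-- **All words are fixed by the identity**: `F_1 = (x_1 + ⋯ + x_N)^{#ι} = p_1^{#ι}`
(`∑_w ∏_p x_{w p} = ∏_p ∑_i x_i`). [cite: FultonHarrisGTM129, §4.1 (4.10)] -/
theorem fixedWordPoly_one {ι : Type*} [Fintype ι] [DecidableEq ι] :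
    fixedWordPoly N (1 : Equiv.Perm ι) = psum (Fin N) ℤ 1 ^ Fintype.card ι := by
  classical
  unfold fixedWordPoly
  have hfilter :
      (univ.filter fun w : ι → Fin N => w ∘ ⇑(1 : Equiv.Perm ι) = w) = univ := by
    refine Finset.filter_true_of_mem fun w _ => ?_
    rfl
  rw [hfilter, psum_fin_eq_sum]
  simp_rw [pow_one]
  rw [← Finset.card_univ, ← Finset.prod_const, Finset.prod_univ_sum, Fintype.piFinset_univ]

/-- **The fixed-word enumerator is the power-sum product of the cycle type**:
`F_σ = (∏_{m ∈ cycleType σ} p_m) · p_1^{#ι - ∑ cycleType σ}` for every permutation `σ` of a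
finite set `ι` (the exponent is the number of fixed points). Strong induction on `#ι`, peeling a
cycle with `fixedWordPoly_cycle_mul`. [cite: FultonHarrisGTM129, §4.1 (4.10)] -/
theorem fixedWordPoly_eq_prod_cycleType_aux (n : ℕ) :
    ∀ {ι : Type*} [Fintype ι] [DecidableEq ι] (σ : Equiv.Perm ι), Fintype.card ι = n →
      fixedWordPoly N σ = (σ.cycleType.map (psum (Fin N) ℤ)).prod *
        psum (Fin N) ℤ 1 ^ (Fintype.card ι - σ.cycleType.sum) := by
  induction n using Nat.strong_induction_on with
  | _ n ih =>
    intro ι _ _ σ hn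
    classical
    by_cases h1 : σ = 1
    · subst h1
      rw [Equiv.Perm.cycleType_one, Multiset.map_zero, Multiset.prod_zero, one_mul,
        Multiset.sum_zero, Nat.sub_zero, fixedWordPoly_one]
    · have hne : σ.cycleType ≠ 0 := fun h => h1 (Equiv.Perm.cycleType_eq_zero.1 h)
      obtain ⟨m, hm⟩ := Multiset.exists_mem_of_ne_zero hne
      have hm2 : 2 ≤ m := Equiv.Perm.two_le_of_mem_cycleType hm
      obtain ⟨c, τ, rfl, hd, hc, hcard⟩ := Equiv.Perm.mem_cycleType_iff.1 hm
      have hmn : m ≤ n := by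
        rw [← hcard, ← hn]
        exact Finset.card_le_univ _
      set τB := τ.subtypePerm (p := fun x => x ∈ c.supportᶜ)
        (fun x => mem_compl_support_iff_of_disjoint hd x) with hτB
      have hcardB : Fintype.card ↥(c.supportᶜ) = n - m := by
        rw [Fintype.card_coe, Finset.card_compl, hcard, hn]
      have hlt : n - m < n := by omega
      have ihB := ih (n - m) hlt τB hcardB
      rw [fixedWordPoly_cycle_mul hd hc, ← psum_fin_eq_sum, hcard, ihB, hτB,
        cycleType_subtypePerm_of_disjoint hd, hd.cycleType_mul, hc.cycleType, hcard, hcardB,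
        hn, Multiset.singleton_add, Multiset.map_cons, Multiset.prod_cons, Multiset.sum_cons,
        mul_assoc, Nat.sub_sub]

/-- **The fixed-word enumerator is the power-sum product of the cycle type**:
`F_σ = (∏_{m ∈ cycleType σ} p_m) · p_1^{#ι - ∑ cycleType σ}`.
[cite: FultonHarrisGTM129, §4.1 (4.10)] -/
theorem fixedWordPoly_eq_prod_cycleType {ι : Type*} [Fintype ι] [DecidableEq ι]
    (σ : Equiv.Perm ι) :
    fixedWordPoly N σ = (σ.cycleType.map (psum (Fin N) ℤ)).prod *
      psum (Fin N) ℤ 1 ^ (Fintype.card ι - σ.cycleType.sum) :=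
  fixedWordPoly_eq_prod_cycleType_aux (Fintype.card ι) σ rfl

/-- **Frobenius's coefficient is a function of the cycle type**:
`X^{lam}(σ) = [x^{lam+ρ}] ((∏_{m ∈ ms} p_m) · (a_ρ · p_1^{#ι - ∑ ms}))` for any list `ms`
enumerating the cycle type of `σ`. [cite: FultonHarrisGTM129, Theorem 4.10 (4.10)] -/
theorem frobeniusChar_eq_coeff_prod_cycleType {ι : Type*} [Fintype ι] [DecidableEq ι]
    (lam : Fin N → ℕ) (σ : Equiv.Perm ι) {ms : List ℕ}
    (hms : (ms : Multiset ℕ) = σ.cycleType) :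
    frobeniusChar N lam σ = coeff (Finsupp.equivFunOnFinite.symm (lam + rho N))
      ((ms.map (psum (Fin N) ℤ)).prod *
        (alternant (fun i => (X i : MvPolynomial (Fin N) ℤ)) (rho N) *
          psum (Fin N) ℤ 1 ^ (Fintype.card ι - ms.sum))) := by
  rw [frobeniusChar_def, fixedWordPoly_eq_prod_cycleType, ← hms, prod_map_psum_coe,
    Multiset.sum_coe, mul_left_comm]

end Factorization

end Literature.RepresentationTheory.FiniteGroups

end
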